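import Summits.CriticalPhenomena.PercolationContinuityZ3.Theorems.Transplant.FKConnectivityAllQForestContractionMono
import HarnessLib

/-!
# Two exact identities of the square-free adjacent forest Rayleigh counts: the one-class sum VANISHES at `a = v`
# (swap-all-but-`e` involution) and a pair PARALLEL to `e` in the quotient forces `bad = good` (exchange involution)

Support file (`--supports stmt-CriticalPhenomena-4575`), FK sub-lane `prim-bschramm-fk-1` (gen 25) of the post-continuity programme;
builds on p205010 (kernel theorem, internal audit signed; external expert review pending).  No definitions, no named facts, no sorries;
standard axioms.  Companion of `…ForestHubPairDecomposition` (p366299: one-edge decomposition, (★) ⇒ (♣)⁰) and `…ForestHubPairAbsorption`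
(the absorption node AAM and the adjacent-vertex identity); these are the identities F3 and F6 of the induction architecture
"AAM ⇒ (★) ⇒ (♣)⁰" (memo bschramm/FROM-fk-1-g25-HUB-PAIR-DECOMPOSITION.md §6).  Reachability events are spelled out
(`{ω | (openGraph ω).Reachable o a}`) so that the file elaborates against the older imports.

NOTATION.  Fibre `(M, u₀)` (first class `ω ⊇ u₀`, second class `ω ∆ M ⊇ u₀`), `e = ov`, `f = oy`; `T_A(o,a)` = "a reachable from o in the first
class, not in the second"; `sRR, sBB, dRB, dBR` the four `(e,f)`-counts on it, `s_A = dRB + dBR − sRR − sBB`; `bad = #(Fo ∩ {e,f ∈ ω}, Fo)`,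
`good = #(Fo ∩ {e ∈ ω}, Fo ∩ {f ∈ ω})`.
* **`hubPair_second_e_eq_zero_at_v`**, **`hubPair_sRR_eq_dRB_at_v`**, **`hubPairOneClass_at_v`** (F3): on `T_A(o,v)` the second class never holds
  `e`; the map `ω ↦ (ω ∆ M) ∪ {e}` ("swap every free pair except `e`") is an involution of `T_A(o,v) ∩ {e first}` exchanging `f` first / `f` second,
  so `sRR = dRB`, `sBB = dBR = 0`, and (★) `HubPairOneClassOn` holds with EQUALITY at `a = v`.
* **`not_mem_of_parallel`**, **`isForestCfg_exchange_parallel`**, **`exchange_fibre_facts`**, **`adjForestNoSq_bad_eq_good_of_parallel`** (F6): if a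
  free pair `e' = o'v' ∉ {e,f}` joins the pinned class of `o` to the pinned class of `v` ("`e` is doubled in the quotient multigraph"), then `e` and
  `e'` are never in one class, the exchange `ω ↦ (ω ∖ e) ∪ e'` is a bijection from bad onto `{e' ∈ ω, e ∉ ω, f ∈ ω}`, and the global swap carries
  the latter onto good: **`bad = good`** — the node (♣)⁰ is an equality on every fibre in which `e` (or, symmetrically, `f`) has a parallel.
  (This is the fact behind `margin((G'+oa)/oa) = 0` in the base case `N(a) ⊆ {v,y}` of the absorption descent, and behind g18's census reduction
  "doubled pairs ⇒ equality".)
[cite: SempleWelsh2008, Conj. 1.1 (p. 2); Thm. 4.2 (p. 11)] [cite: CibulkaHladkyLaCroixWagner2008, Thm. 1 (p. 2)] [cite: Linusson2011, Prop. 2.6]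
[cite: Grimmett2006, §1.5 (p. 13)]
-/

noncomputable section

namespace Summit.CriticalPhenomena.PercolationContinuityZ3.Theorems
namespace FK

open Set Literature.Probability.LatticeModels Literature.Probability.Percolation
open scoped Classical symmDiff

variable {V : Type*} [Fintype V]

omit [Fintype V] in
/-- A free pair lies in the partner iff it does not lie in the configuration. [folklore] -/
theorem free_mem_partner_iff {M ω : BondConfig V} {g : Sym2 V} (hgM : g ∈ M) : g ∈ ω ∆ M ↔ g ∉ ω := by
  rw [Set.mem_symmDiff]
  constructor
  · rintro (⟨_, h⟩ | ⟨_, h⟩)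
    · exact absurd hgM h
    · exact h
  · exact fun h => Or.inr ⟨hgM, h⟩

/-! ### F3: at `a = v` the one-class sum vanishes -/

section AtV

variable {M u₀ : BondConfig V} {o v y : V}

/-- On `T_A(o,v)` the second class never contains `e` (it would join `o` to `v`): the count with `e` in the second class is `0`.
[cite: Linusson2011, Prop. 2.6] -/
theorem hubPair_second_e_eq_zero_at_v (hov : o ≠ v) (P Q : Set (BondConfig V)) :
    fibreCount M u₀ (P ∩ {ω | (openGraph ω).Reachable o v})
      (Q ∩ {ζ | s(o, v) ∈ ζ} ∩ {ζ | ¬ (openGraph ζ).Reachable o v}) = 0 :=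
  fibreCount_eq_zero_of_forall _ _ _ _ fun _ _ _ hB =>
    hB.2 ((openGraph_adj _ _ _).2 ⟨hB.1.2, hov⟩).reachable

/-- **F3 — swap every free pair except `e`.**  On `T_A(o,v)` (first class joins `o,v`; second does not) the map `ω ↦ (ω ∆ M) ∪ {e}` is an
involution exchanging "`f` first" and "`f` second" while keeping `e` first: `sRR(o,v) = dRB(o,v)`.
[cite: SempleWelsh2008, Conj. 1.1 (p. 2)] [cite: Linusson2011, Prop. 2.6] -/
theorem hubPair_sRR_eq_dRB_at_v (hd : Disjoint u₀ M) (hov : o ≠ v) (hvy : v ≠ y) (heM : s(o, v) ∈ M) :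
    fibreCount M u₀ (forestEv V ∩ {ω | s(o, v) ∈ ω ∧ s(o, y) ∈ ω} ∩ {ω | (openGraph ω).Reachable o v})
        (forestEv V ∩ {ζ | ¬ (openGraph ζ).Reachable o v}) =
      fibreCount M u₀ (forestEv V ∩ {ω | s(o, v) ∈ ω} ∩ {ω | (openGraph ω).Reachable o v})
        (forestEv V ∩ {ζ | s(o, y) ∈ ζ} ∩ {ζ | ¬ (openGraph ζ).Reachable o v}) := by
  have hef : s(o, v) ≠ s(o, y) := fun h' => hvy (Sym2.congr_right.1 h')
  -- the involution and its bookkeeping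
  set φ : BondConfig V → BondConfig V := fun ω => insert s(o, v) (ω ∆ M) with hφ
  have key : ∀ ω : BondConfig V, ω \ M = u₀ → s(o, v) ∈ ω → IsForestCfg ω → IsForestCfg (ω ∆ M) →
      ¬ (openGraph (ω ∆ M)).Reachable o v →
      φ ω \ M = u₀ ∧ (φ ω) ∆ M = ω \ {s(o, v)} ∧ IsForestCfg (φ ω) ∧ IsForestCfg (ω \ {s(o, v)}) ∧
        (openGraph (φ ω)).Reachable o v ∧ ¬ (openGraph (ω \ {s(o, v)})).Reachable o v ∧ φ (φ ω) = ω := by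
    intro ω hω he hF hFB hnr
    have heB : s(o, v) ∉ ω ∆ M := fun h => (((free_mem_partner_iff heM)).1 h) he
    have hsub : u₀ ⊆ ω := fun p hp => (show p ∈ ω \ M by rw [hω]; exact hp).1
    have h1 : φ ω \ M = u₀ := by
      ext p
      simp only [hφ, mem_sdiff, mem_insert_iff, Set.mem_symmDiff]
      constructor
      · rintro ⟨h | h, hpM⟩
        · exact absurd heM (h ▸ hpM)
        · rcases h with ⟨hpω, -⟩ | ⟨hpM', -⟩
          · have : p ∈ ω \ M := ⟨hpω, hpM⟩; rwa [hω] at this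
          · exact absurd hpM' hpM
      · intro hpu; exact ⟨Or.inr (Or.inl ⟨hsub hpu, fun hpM => hd.le_bot ⟨hpu, hpM⟩⟩), fun hpM => hd.le_bot ⟨hpu, hpM⟩⟩
    have h2 : (φ ω) ∆ M = ω \ {s(o, v)} := by
      ext p
      simp only [hφ, Set.mem_symmDiff, mem_insert_iff, mem_sdiff, mem_singleton_iff]
      constructor
      · rintro (⟨h | ⟨hpω, hpM⟩ | ⟨hpM, hpω⟩, hpM2⟩ | ⟨hpM, hn⟩)
        · exact absurd heM (h ▸ hpM2)
        · exact ⟨hpω, fun hpe => hpM (hpe ▸ heM)⟩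
        · exact absurd hpM hpM2
        · refine ⟨?_, fun hpe => hn (Or.inl hpe)⟩
          by_contra hpω; exact hn (Or.inr (Or.inr ⟨hpM, hpω⟩))
      · rintro ⟨hpω, hpe⟩
        by_cases hpM : p ∈ M
        · exact Or.inr ⟨hpM, fun h => h.elim hpe fun h => h.elim (fun h => h.2 hpM) fun h => h.2 hpω⟩
        · exact Or.inl ⟨Or.inr (Or.inl ⟨hpω, hpM⟩), hpM⟩
    have h3 : IsForestCfg (φ ω) := (isForestCfg_insert_iff hov heB).2 ⟨hFB, hnr⟩
    have h4 : IsForestCfg (ω \ {s(o, v)}) := ⟨fun p hp => hF.1 p hp.1, hF.2.anti (openGraph_mono sdiff_subset)⟩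
    have h5 : (openGraph (φ ω)).Reachable o v := ((openGraph_adj _ _ _).2 ⟨mem_insert _ _, hov⟩).reachable
    have h6 : ¬ (openGraph (ω \ {s(o, v)})).Reachable o v := by
      intro hr
      have : IsForestCfg (insert s(o, v) (ω \ {s(o, v)})) := by rw [insert_sdiff_singleton, insert_eq_of_mem he]; exact hF
      exact ((isForestCfg_insert_iff hov (fun h => h.2 rfl)).1 this).2 hr
    have h7 : φ (φ ω) = ω := by
      show insert s(o, v) ((φ ω) ∆ M) = ω
      rw [h2, insert_sdiff_singleton, insert_eq_of_mem he]
    exact ⟨h1, h2, h3, h4, h5, h6, h7⟩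
  refine fibreCount_eq_of_bij φ φ (fun ω hω hA hB => ?_) (fun ω hω hA hB => ?_)
  · obtain ⟨⟨hF, he, hf⟩, -⟩ := hA
    obtain ⟨hFB, hnr⟩ := hB
    obtain ⟨h1, h2, h3, h4, h5, h6, h7⟩ := key ω hω he hF hFB hnr
    refine ⟨h1, ⟨⟨h3, mem_insert _ _⟩, h5⟩, ?_, h7⟩
    rw [h2]; exact ⟨⟨h4, hf, fun h' => hef h'.symm⟩, h6⟩
  · obtain ⟨⟨hF, he⟩, -⟩ := hA
    obtain ⟨⟨hFB, hf⟩, hnr⟩ := hB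
    obtain ⟨h1, h2, h3, h4, h5, h6, h7⟩ := key ω hω he hF hFB hnr
    refine ⟨h1, ⟨⟨h3, mem_insert _ _, mem_insert_of_mem _ hf⟩, h5⟩, ?_, h7⟩
    rw [h2]; exact ⟨h4, h6⟩

/-- **(★) at `a = v` holds with equality**: `sRR + sBB = dRB + dBR` on `T_A(o,v)` (`sBB = dBR = 0`, `sRR = dRB`).
[cite: SempleWelsh2008, Conj. 1.1 (p. 2)] [cite: Linusson2011, Prop. 2.6] -/
theorem hubPairOneClass_at_v (hd : Disjoint u₀ M) (hov : o ≠ v) (hvy : v ≠ y) (heM : s(o, v) ∈ M) :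
    fibreCount M u₀ (forestEv V ∩ {ω | s(o, v) ∈ ω ∧ s(o, y) ∈ ω} ∩ {ω | (openGraph ω).Reachable o v})
          (forestEv V ∩ {ζ | ¬ (openGraph ζ).Reachable o v}) +
        fibreCount M u₀ (forestEv V ∩ {ω | (openGraph ω).Reachable o v})
          (forestEv V ∩ {ζ | s(o, v) ∈ ζ ∧ s(o, y) ∈ ζ} ∩ {ζ | ¬ (openGraph ζ).Reachable o v}) =
      fibreCount M u₀ (forestEv V ∩ {ω | s(o, v) ∈ ω} ∩ {ω | (openGraph ω).Reachable o v})
          (forestEv V ∩ {ζ | s(o, y) ∈ ζ} ∩ {ζ | ¬ (openGraph ζ).Reachable o v}) +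
        fibreCount M u₀ (forestEv V ∩ {ω | s(o, y) ∈ ω} ∩ {ω | (openGraph ω).Reachable o v})
          (forestEv V ∩ {ζ | s(o, v) ∈ ζ} ∩ {ζ | ¬ (openGraph ζ).Reachable o v}) := by
  have h0 : fibreCount M u₀ (forestEv V ∩ {ω | (openGraph ω).Reachable o v})
      (forestEv V ∩ {ζ | s(o, v) ∈ ζ ∧ s(o, y) ∈ ζ} ∩ {ζ | ¬ (openGraph ζ).Reachable o v}) = 0 := by
    have hsplit : forestEv V ∩ {ζ : BondConfig V | s(o, v) ∈ ζ ∧ s(o, y) ∈ ζ} =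
        (forestEv V ∩ {ζ | s(o, y) ∈ ζ}) ∩ {ζ | s(o, v) ∈ ζ} := by
      ext ζ; simp only [mem_inter_iff, mem_setOf_eq]; tauto
    rw [hsplit]; exact hubPair_second_e_eq_zero_at_v hov _ _
  have h0' := hubPair_second_e_eq_zero_at_v (M := M) (u₀ := u₀) hov (forestEv V ∩ {ω | s(o, y) ∈ ω}) (forestEv V)
  rw [h0, h0', hubPair_sRR_eq_dRB_at_v hd hov hvy heM]

end AtV

/-! ### F6: a free pair parallel to `e` in the quotient forces `bad = good` -/

section Parallel

variable {M u₀ : BondConfig V} {o v y o' v' : V}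

omit [Fintype V] in
/-- In a forest configuration containing the pinned pairs, the free pair `e = ov` and a second pair `e' = o'v' ∉ u₀` with `o ~ o'`, `v ~ v'` pinned are
never present together (the pinned detours and the two pairs would close a cycle). [cite: Grimmett2006, §1.5 (p. 13)] -/
theorem not_mem_of_parallel {ω : BondConfig V} (hsub : u₀ ⊆ ω) (hF : IsForestCfg ω) (ho : (openGraph u₀).Reachable o o')
    (hv : (openGraph u₀).Reachable v v') (hov' : o' ≠ v') (he'u : s(o', v') ∉ u₀) (hne : s(o', v') ≠ s(o, v)) (hov : o ≠ v)
    (he : s(o, v) ∈ ω) : s(o', v') ∉ ω := by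
  intro he'
  -- remove `e'`: the pinned pairs and `e` survive, and join `o'` to `v'`
  have hsub' : insert s(o, v) u₀ ⊆ ω \ {s(o', v')} := by
    rintro p (rfl | hp)
    · exact ⟨he, fun h => hne (mem_singleton_iff.1 h).symm⟩
    · exact ⟨hsub hp, fun h => he'u ((mem_singleton_iff.1 h) ▸ hp)⟩
  have hr : (openGraph (ω \ {s(o', v')})).Reachable o' v' := by
    have h1 : (openGraph (ω \ {s(o', v')})).Reachable o o' := ho.mono (openGraph_mono fun p hp => hsub' (mem_insert_of_mem _ hp))
    have h2 : (openGraph (ω \ {s(o', v')})).Reachable v v' := hv.mono (openGraph_mono fun p hp => hsub' (mem_insert_of_mem _ hp))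
    have h3 : (openGraph (ω \ {s(o', v')})).Adj o v := (openGraph_adj _ _ _).2 ⟨hsub' (mem_insert _ _), hov⟩
    exact h1.symm.trans (h3.reachable.trans h2)
  have hback : insert s(o', v') (ω \ {s(o', v')}) = ω := by rw [insert_sdiff_singleton, insert_eq_of_mem he']
  have hF' : IsForestCfg (insert s(o', v') (ω \ {s(o', v')})) := by rw [hback]; exact hF
  exact ((isForestCfg_insert_iff hov' (fun h => h.2 rfl)).1 hF').2 hr

omit [Fintype V] in
/-- Exchanging `e` for a parallel pair `e'` keeps a forest a forest. [cite: Grimmett2006, §1.5 (p. 13)] -/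
theorem isForestCfg_exchange_parallel {ω : BondConfig V} (hsub : u₀ ⊆ ω) (hF : IsForestCfg ω) (ho : (openGraph u₀).Reachable o o')
    (hv : (openGraph u₀).Reachable v v') (hov' : o' ≠ v') (he'u : s(o', v') ∉ u₀) (heu : s(o, v) ∉ u₀) (hne : s(o', v') ≠ s(o, v))
    (hov : o ≠ v) (he : s(o, v) ∈ ω) : IsForestCfg (insert s(o', v') (ω \ {s(o, v)})) := by
  have he' : s(o', v') ∉ ω := not_mem_of_parallel hsub hF ho hv hov' he'u hne hov he
  refine (isForestCfg_insert_iff hov' (fun h => he' h.1)).2 ⟨⟨fun p hp => hF.1 p hp.1, hF.2.anti (openGraph_mono sdiff_subset)⟩, fun hr => ?_⟩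
  -- an `o'–v'` path avoiding `e` plus the pinned detours gives an `o–v` path avoiding `e`: cycle with `e`
  have hsub' : u₀ ⊆ ω \ {s(o, v)} := fun p hp => ⟨hsub hp, fun h => heu ((mem_singleton_iff.1 h) ▸ hp)⟩
  have h1 : (openGraph (ω \ {s(o, v)})).Reachable o o' := ho.mono (openGraph_mono hsub')
  have h2 : (openGraph (ω \ {s(o, v)})).Reachable v v' := hv.mono (openGraph_mono hsub')
  have hr' : (openGraph (ω \ {s(o, v)})).Reachable o v := h1.trans (hr.trans h2.symm)
  have hback : insert s(o, v) (ω \ {s(o, v)}) = ω := by rw [insert_sdiff_singleton, insert_eq_of_mem he]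
  have hF' : IsForestCfg (insert s(o, v) (ω \ {s(o, v)})) := by rw [hback]; exact hF
  exact ((isForestCfg_insert_iff hov (fun h => h.2 rfl)).1 hF').2 hr'

omit [Fintype V] in
/-- Bookkeeping of the exchange `ω ↦ (ω ∖ {e}) ∪ {e'}` on a fibre: fibre, partner, and the inverse exchange. [folklore] -/
theorem exchange_fibre_facts {ω : BondConfig V} {e e' : Sym2 V} (heM : e ∈ M) (he'M : e' ∈ M) (hne : e' ≠ e)
    (hω : ω \ M = u₀) (he : e ∈ ω) (he' : e' ∉ ω) :
    insert e' (ω \ {e}) \ M = u₀ ∧ (insert e' (ω \ {e})) ∆ M = insert e ((ω ∆ M) \ {e'}) ∧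
      insert e (insert e' (ω \ {e}) \ {e'}) = ω := by
  have f3 : ∀ p, (p ∈ ω ∧ p ∉ M) ↔ p ∈ u₀ := fun p => by rw [← hω]; rfl
  have f1 : ∀ p : Sym2 V, p = e' → p ∈ M := fun p h => h ▸ he'M
  have f2 : ∀ p : Sym2 V, p = e → p ∈ M := fun p h => h ▸ heM
  have f4 : ∀ p : Sym2 V, p = e → p ∈ ω := fun p h => h ▸ he
  have f5 : ∀ p : Sym2 V, p = e' → p ∉ ω := fun p h => h ▸ he'
  have f6 : ∀ p : Sym2 V, p = e → p ≠ e' := fun p h h' => hne (h'.symm.trans h)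
  refine ⟨?_, ?_, ?_⟩
  · ext p
    have := f1 p; have := f2 p; have := f3 p
    simp only [mem_sdiff, mem_insert_iff, mem_singleton_iff]
    tauto
  · ext p
    have := f1 p; have := f2 p; have := f4 p; have := f5 p; have := f6 p
    simp only [Set.mem_symmDiff, mem_sdiff, mem_insert_iff, mem_singleton_iff]
    tauto
  · have h1 : insert e' (ω \ {e}) \ {e'} = ω \ {e} := insert_sdiff_self_of_notMem fun h => he' h.1
    rw [h1, insert_sdiff_singleton, insert_eq_of_mem he]

/-- **F6 — a pair parallel to `e` forces `bad = good`.**  If a free pair `e' = o'v' ∉ {e, f}` joins the pinned class of `o` to the pinned class of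
`v`, then `#(Fo ∩ {e,f ∈ ω}, Fo) = #(Fo ∩ {e ∈ ω}, Fo ∩ {f ∈ ω})` on `(M, u₀)`: the exchange `ω ↦ ω ∆ {e, e'}` maps bad onto
`{e' ∈ ω, e ∉ ω, f ∈ ω}`, which the global swap maps onto good. [cite: SempleWelsh2008, Conj. 1.1 (p. 2)] [cite: Linusson2011, Prop. 2.6] -/
theorem adjForestNoSq_bad_eq_good_of_parallel (hd : Disjoint u₀ M) (heM : s(o, v) ∈ M) (he'M : s(o', v') ∈ M)
    (hne : s(o', v') ≠ s(o, v)) (hnf : s(o', v') ≠ s(o, y)) (hov : o ≠ v) (hov' : o' ≠ v') (hvy : v ≠ y)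
    (ho : (openGraph u₀).Reachable o o') (hv : (openGraph u₀).Reachable v v') :
    fibreCount M u₀ (forestEv V ∩ {ω | s(o, v) ∈ ω ∧ s(o, y) ∈ ω}) (forestEv V) =
      fibreCount M u₀ (forestEv V ∩ {ω | s(o, v) ∈ ω}) (forestEv V ∩ {ω | s(o, y) ∈ ω}) := by
  have heu : s(o, v) ∉ u₀ := fun h => hd.le_bot ⟨h, heM⟩
  have he'u : s(o', v') ∉ u₀ := fun h => hd.le_bot ⟨h, he'M⟩
  have hef : s(o, v) ≠ s(o, y) := fun h' => hvy (Sym2.congr_right.1 h')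
  -- Step 1: bad = X by the exchange
  have hX : fibreCount M u₀ (forestEv V ∩ {ω | s(o, v) ∈ ω ∧ s(o, y) ∈ ω}) (forestEv V) =
      fibreCount M u₀ (forestEv V ∩ {ω | s(o', v') ∈ ω ∧ s(o, v) ∉ ω ∧ s(o, y) ∈ ω}) (forestEv V) := by
    refine fibreCount_eq_of_bij (fun ω => insert s(o', v') (ω \ {s(o, v)})) (fun ω => insert s(o, v) (ω \ {s(o', v')}))
      (fun ω hω hA hB => ?_) (fun ω hω hA hB => ?_)
    · obtain ⟨hF, he, hf⟩ := hA
      have hsub : u₀ ⊆ ω := fun p hp => (show p ∈ ω \ M by rw [hω]; exact hp).1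
      have hsubB : u₀ ⊆ ω ∆ M := fun p hp =>
        Set.mem_symmDiff.2 (Or.inl ⟨(show p ∈ ω \ M by rw [hω]; exact hp).1, fun hpM => hd.le_bot ⟨hp, hpM⟩⟩)
      have he' : s(o', v') ∉ ω := not_mem_of_parallel hsub hF ho hv hov' he'u hne hov he
      have he'B : s(o', v') ∈ ω ∆ M := ((free_mem_partner_iff he'M)).2 he'
      obtain ⟨h1, h2, h3⟩ := exchange_fibre_facts heM he'M hne hω he he'
      refine ⟨h1, ⟨isForestCfg_exchange_parallel hsub hF ho hv hov' he'u heu hne hov he, mem_insert _ _,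
        fun h => ?_, mem_insert_of_mem _ ⟨hf, fun h => hef (mem_singleton_iff.1 h).symm⟩⟩, ?_, h3⟩
      · rcases (mem_insert_iff.1 h) with h | h
        · exact hne h.symm
        · exact h.2 rfl
      · show (insert s(o', v') (ω \ {s(o, v)})) ∆ M ∈ forestEv V
        rw [h2]
        exact isForestCfg_exchange_parallel (o := o') (v := v') (o' := o) (v' := v) hsubB hB ho.symm hv.symm hov heu he'u hne.symm hov' he'B
    · obtain ⟨hF, he', he, hf⟩ := hA
      have hsub : u₀ ⊆ ω := fun p hp => (show p ∈ ω \ M by rw [hω]; exact hp).1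
      have hsubB : u₀ ⊆ ω ∆ M := fun p hp =>
        Set.mem_symmDiff.2 (Or.inl ⟨(show p ∈ ω \ M by rw [hω]; exact hp).1, fun hpM => hd.le_bot ⟨hp, hpM⟩⟩)
      have heB : s(o, v) ∈ ω ∆ M := ((free_mem_partner_iff heM)).2 he
      obtain ⟨h1, h2, h3⟩ := exchange_fibre_facts he'M heM hne.symm hω he' he
      refine ⟨h1, ⟨isForestCfg_exchange_parallel (o := o') (v := v') (o' := o) (v' := v) hsub hF ho.symm hv.symm hov heu he'u hne.symm hov' he',
        mem_insert _ _, mem_insert_of_mem _ ⟨hf, fun h => hnf (mem_singleton_iff.1 h).symm⟩⟩, ?_, h3⟩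
      show (insert s(o, v) (ω \ {s(o', v')})) ∆ M ∈ forestEv V
      rw [h2]
      exact isForestCfg_exchange_parallel hsubB hB ho hv hov' he'u heu hne hov heB
  -- Step 2: X = good by the global swap
  rw [hX, fibreCount_swap]
  refine fibreCount_congr_fibre M u₀ fun ω hω => ?_
  have hsub : u₀ ⊆ ω := fun p hp => (show p ∈ ω \ M by rw [hω]; exact hp).1
  have hfreeE : s(o, v) ∈ ω ∆ M ↔ s(o, v) ∉ ω := (free_mem_partner_iff heM)
  have hfreeE' : s(o', v') ∈ ω ∆ M ↔ s(o', v') ∉ ω := (free_mem_partner_iff he'M)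
  simp only [mem_inter_iff, mem_setOf_eq]
  constructor
  · rintro ⟨hF, hFB, -, heB, hfB⟩
    have he : s(o, v) ∈ ω := by by_contra hne'; exact heB (hfreeE.2 hne')
    exact ⟨⟨hF, he⟩, hFB, hfB⟩
  · rintro ⟨⟨hF, he⟩, hFB, hfB⟩
    have he' : s(o', v') ∉ ω := not_mem_of_parallel hsub hF ho hv hov' he'u hne hov he
    exact ⟨hF, hFB, hfreeE'.2 he', fun h => (hfreeE.1 h) he, hfB⟩

end Parallel

end FK
end Summit.CriticalPhenomena.PercolationContinuityZ3.Theorems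

end
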